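import Summits.ResolutionOfSingularities.ResolutionOfSingularities.Theorems.WeightDescentKernels
import Summits.ResolutionOfSingularities.ResolutionOfSingularities.Theorems.MaxContactCutMarkingBudget
import HarnessLib

/-!
# MaxContactCutWeightDescent — decomp-res node «WeightDescent» (lens-4 g16; CRITIC-LEDGER row 108 CLEARED:
DECIDED-MOD-PORT +2 cells)
refining the MaxContactCut aside 32260 (host of the lens-4 column).  Tree file 3/3 of the node.

Content VERBATIM from the decomp-res lens-4 cumulative file `HOME/decomp-res-lens-4/g18/CouplingCut.lean` (sha256
5bf7b2ca8f7311e8;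
its §1–§6 = g14 HugValuationCut, ALREADY in the tree as `Theorems/HugValuationCut{Chains,Classes,Kernels}` +
`MaxContactCutHugValuationCut`; §7–§12 = g15 «MarkingBudget» @369c12ac; §13–§17 = g16 «WeightDescent»
@1cb1c32f; §18–§23 = g17
«FactorContact» @daf245ab; §24–§31 = g18 «CouplingCut»).  HOME = run/shared/lean/pub/decomp-res.

Inside the Theses cone: §17 BY NAME — the STRONG INDUCTION ON THE WEIGHT: `MaxContactCut.ForcedTowersTerminate n`
from the g16 residuals at
weight `n` and all lower weights (`forcedTowersTerminate_of_g16`), 30253 `NoForcedTowers` / 32260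
`NoSingularSurfaceHuggingTowers` /
32203 / 31570 from the all-weights residuals modulo the COSTUME ports (`noForcedTowers_of_g16`, EXACT
`noForcedTowers_iff_g16`), necessity
port-free (`…_of_item`, `residuals_of_noForcedTowers`).

[WRITER NOTE (decomp-res writer g6): the whole lens-4 chain lives in ONE namespace `…Theorems.HugValuationCut` (the tree's g14
namespace) so that the lens's `HugChain.`/`HugShadow.`/`MarkedShadow.` dot-notation extends the landed structures
verbatim; the lens's
`noTower_iff_perfect_and_imperfect` is the tree's `ContactShadowKernels.noTower_iff_columns`; `set_option` lines
dropped; cone-free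
(no `Theses` import) so the route file can import it for asides; the BY-NAME wiring to the MaxContactCut items is in the
`MaxContactCut<Node>` companion files.]
(Sources: CossartJannsenSaito2020 Key Thm. 6.40, Cor. 6.37, Lem. 6.35/6.36; BierstoneGrigorievMilmanWlodarczyk2011
§3 (marked ideals, Lem. 3.2.1, §3.7); CossartPiltant2019; Abhyankar1956; Cutkosky2009 §2.1.)
-/

noncomputable section

open CategoryTheory AlgebraicGeometry IsLocalRing
open Literature.AlgebraicGeometry.Resolution
open Summit.ResolutionOfSingularities.ResolutionOfSingularities.Theses
open Summit.ResolutionOfSingularities.ResolutionOfSingularities.Theorems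
open WeakOrderReduction ForcedTowerClasses DivergentTowerClasses MonomialTowerClasses
open HugDimensionClasses HugDimensionKernels SurfaceShadowClasses SurfaceShadowKernels
open ContactShadowClasses (NoTowerImperfect)
open ContactShadowKernels (noTowerImperfect_of_noTower noTowerImperfect_mono noTower_iff_columns)
open NearPointCut (SingularClass singularSurface_iff_noTower)

namespace Summit.ResolutionOfSingularities.ResolutionOfSingularities.Theorems.HugValuationCut

variable {K : Type} [Field K]

/-! ## §17 (g16 · NEW) Up to the booked MaxContactCut items BY NAME — the strong induction on the weight -/

/-- **THE ROOT PIECE AT EVERY WEIGHT BY STRONG INDUCTION ON THE WEIGHT** — `∀ n ≥ 1, ForcedTowersTerminate n` from the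
tree's decided pieces and ports at every weight (monomial corner 32205, curve law 32207, surface law 32262, the
hypersurface leaf 32204, g14's `ShadowPort`, g15's `MarkingPort` and residual (O)), the g16 COSTUME port `DescentPort`
and the three g16 residual cells; the factor-isolated cell never appears: at weight `n` it descends to the root piece
at a weight `< n` (`Nat.strong_induction_on`). [folklore] -/
theorem forcedTowersTerminate_of_g16 (hMo : MaxContactCut.MonomialCornerAll) (hC : MaxContactCut.CurveLawAll)
    (hSL : MaxContactCut.SurfaceLawAll) (hH : MaxContactCut.NoHypersurfaceHuggingTowers) (hP : ShadowPortAll)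
    (hM : MarkingPortAll) (hDesc : DescentPortAll) (hO : NoOffLocusShadowTowers) (hNP : NoNonPrincipalInLocusTowers)
    (hPu : NoPurePrincipalTowers) (hDr : NoDriftingTowers) : ∀ n : ℕ, 1 ≤ n → ForcedTowersTerminate n := by
  intro n
  induction n using Nat.strong_induction_on with
  | _ n ih =>
    intro hn
    exact ftt_step_of_g16 hn (hMo n hn) (hC n hn) (hSL n hn) (hH n hn) (hP n hn) (hM n hn) (hDesc n hn) (hO n hn)
      (hNP n hn) (hPu n hn) (hDr n hn) fun n' h1 h2 => ih n' h2 h1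

/-- **30253 `MaxContactCut.NoForcedTowers` BY NAME** (definitionally `∀ n ≥ 1, ForcedTowersTerminate n`). [folklore] -/
theorem noForcedTowers_of_g16 (hMo : MaxContactCut.MonomialCornerAll) (hC : MaxContactCut.CurveLawAll)
    (hSL : MaxContactCut.SurfaceLawAll) (hH : MaxContactCut.NoHypersurfaceHuggingTowers) (hP : ShadowPortAll)
    (hM : MarkingPortAll) (hDesc : DescentPortAll) (hO : NoOffLocusShadowTowers) (hNP : NoNonPrincipalInLocusTowers)
    (hPu : NoPurePrincipalTowers) (hDr : NoDriftingTowers) : MaxContactCut.NoForcedTowers :=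
  forcedTowersTerminate_of_g16 hMo hC hSL hH hP hM hDesc hO hNP hPu hDr

/-- **THE HOST TARGET 32260 `MaxContactCut.NoSingularSurfaceHuggingTowers` BY NAME** — through the induction (the lower
weights are discharged by the root piece, so the leaves at every weight are consumed). [folklore] -/
theorem noSingularSurfaceHuggingTowers_of_g16 (hMo : MaxContactCut.MonomialCornerAll) (hC : MaxContactCut.CurveLawAll)
    (hSL : MaxContactCut.SurfaceLawAll) (hH : MaxContactCut.NoHypersurfaceHuggingTowers) (hP : ShadowPortAll)
    (hM : MarkingPortAll) (hDesc : DescentPortAll) (hO : NoOffLocusShadowTowers) (hNP : NoNonPrincipalInLocusTowers)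
    (hPu : NoPurePrincipalTowers) (hDr : NoDriftingTowers) : MaxContactCut.NoSingularSurfaceHuggingTowers :=
  fun n hn => singularSurface_of_g16 (hP n hn) (hM n hn) (hDesc n hn)
    (fun n' h1 _ => forcedTowersTerminate_of_g16 hMo hC hSL hH hP hM hDesc hO hNP hPu hDr n' h1) (hO n hn) (hNP n hn)
    (hPu n hn) (hDr n hn)

/-- The factor-isolated cell over all weights is a CONSEQUENCE (through the root induction). [folklore] -/
theorem noFactorIsolatedTowers_of_g16 (hMo : MaxContactCut.MonomialCornerAll) (hC : MaxContactCut.CurveLawAll)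
    (hSL : MaxContactCut.SurfaceLawAll) (hH : MaxContactCut.NoHypersurfaceHuggingTowers) (hP : ShadowPortAll)
    (hM : MarkingPortAll) (hDesc : DescentPortAll) (hO : NoOffLocusShadowTowers) (hNP : NoNonPrincipalInLocusTowers)
    (hPu : NoPurePrincipalTowers) (hDr : NoDriftingTowers) : NoFactorIsolatedTowers :=
  fun n hn => factorIsolated_of_descent (hDesc n hn)
    fun n' h1 _ => forcedTowersTerminate_of_g16 hMo hC hSL hH hP hM hDesc hO hNP hPu hDr n' h1

/-- Necessity, port-free: 32260 implies the residual (L, P, drifting). [folklore] -/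
theorem noDriftingTowers_of_item (h : MaxContactCut.NoSingularSurfaceHuggingTowers) : NoDriftingTowers :=
  fun n hn => (cells_of_singularSurface (h n hn)).2.2.2

/-- Necessity, port-free: 32260 implies the cell (L, ¬P). [folklore] -/
theorem noNonPrincipalInLocusTowers_of_item (h : MaxContactCut.NoSingularSurfaceHuggingTowers) :
    NoNonPrincipalInLocusTowers :=
  fun n hn => (cells_of_singularSurface (h n hn)).1

/-- Necessity, port-free: 32260 implies the cell (L, P, pure). [folklore] -/
theorem noPurePrincipalTowers_of_item (h : MaxContactCut.NoSingularSurfaceHuggingTowers) : NoPurePrincipalTowers :=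
  fun n hn => (cells_of_singularSurface (h n hn)).2.1

/-- Necessity, port-free: 32260 implies the eliminated cell too. [folklore] -/
theorem noFactorIsolatedTowers_of_item (h : MaxContactCut.NoSingularSurfaceHuggingTowers) : NoFactorIsolatedTowers :=
  fun n hn => (cells_of_singularSurface (h n hn)).2.2.1

/-- Necessity, port-free: 30253 implies every g16 residual (through the tree's `pieces_of_noForcedTowers`). [folklore] -/
theorem residuals_of_noForcedTowers (h : MaxContactCut.NoForcedTowers) :
    NoOffLocusShadowTowers ∧ NoNonPrincipalInLocusTowers ∧ NoPurePrincipalTowers ∧ NoDriftingTowers :=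
  let h' := (MaxContactCutSurfaceShadow.pieces_of_noForcedTowers h).2.2.1
  ⟨noOffLocusShadowTowers_of_item h', noNonPrincipalInLocusTowers_of_item h', noPurePrincipalTowers_of_item h',
    noDriftingTowers_of_item h'⟩

/-- **EXACT AT THE ROOT 30253 modulo the decided pieces and the COSTUME ports**:
`MaxContactCut.NoForcedTowers ⟺ (O) ∧ (L, ¬P) ∧ (L, P, pure) ∧ (L, P, drifting)` over all weights — the
factor-isolated
cell has been INDUCTED AWAY. [folklore] -/
theorem noForcedTowers_iff_g16 (hMo : MaxContactCut.MonomialCornerAll) (hC : MaxContactCut.CurveLawAll)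
    (hSL : MaxContactCut.SurfaceLawAll) (hH : MaxContactCut.NoHypersurfaceHuggingTowers) (hP : ShadowPortAll)
    (hM : MarkingPortAll) (hDesc : DescentPortAll) :
    MaxContactCut.NoForcedTowers ↔
      NoOffLocusShadowTowers ∧ NoNonPrincipalInLocusTowers ∧ NoPurePrincipalTowers ∧ NoDriftingTowers :=
  ⟨residuals_of_noForcedTowers, fun h => noForcedTowers_of_g16 hMo hC hSL hH hP hM hDesc h.1 h.2.1 h.2.2.1 h.2.2.2⟩

/-- **32203 `MaxContactCut.NoSurfaceHuggingTowers` BY NAME** (tree kernel `surfaceLeaf_of_surfaceLaw`). [folklore] -/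
theorem noSurfaceHuggingTowers_of_g16 (hMo : MaxContactCut.MonomialCornerAll) (hC : MaxContactCut.CurveLawAll)
    (hSL : MaxContactCut.SurfaceLawAll) (hH : MaxContactCut.NoHypersurfaceHuggingTowers) (hP : ShadowPortAll)
    (hM : MarkingPortAll) (hDesc : DescentPortAll) (hO : NoOffLocusShadowTowers) (hNP : NoNonPrincipalInLocusTowers)
    (hPu : NoPurePrincipalTowers) (hDr : NoDriftingTowers) : MaxContactCut.NoSurfaceHuggingTowers :=
  fun n hn => surfaceLeaf_of_surfaceLaw (hSL n hn)
    (noSingularSurfaceHuggingTowers_of_g16 hMo hC hSL hH hP hM hDesc hO hNP hPu hDr n hn)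

/-- **31570 `MaxContactCut.NoHuggingTowers` BY NAME** (tree kernel `MaxContactCutSurfaceShadow.noHuggingTowers_of_g11`,
corner hypothesis the tree's `CornerTowerDynamics.noCornerTowers_tree`). [folklore] -/
theorem noHuggingTowers_of_g16 (hMo : MaxContactCut.MonomialCornerAll) (hC : MaxContactCut.CurveLawAll)
    (hSL : MaxContactCut.SurfaceLawAll) (hH : MaxContactCut.NoHypersurfaceHuggingTowers) (hP : ShadowPortAll)
    (hM : MarkingPortAll) (hDesc : DescentPortAll) (hO : NoOffLocusShadowTowers) (hNP : NoNonPrincipalInLocusTowers)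
    (hPu : NoPurePrincipalTowers) (hDr : NoDriftingTowers) : MaxContactCut.NoHuggingTowers :=
  MaxContactCutSurfaceShadow.noHuggingTowers_of_g11 hMo CornerTowerDynamics.noCornerTowers_tree hC hSL
    (noSingularSurfaceHuggingTowers_of_g16 hMo hC hSL hH hP hM hDesc hO hNP hPu hDr) hH

end Summit.ResolutionOfSingularities.ResolutionOfSingularities.Theorems.HugValuationCut
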